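import Summits.BirchSwinnertonDyer.BirchSwinnertonDyer.Theorems.PrintX6AnticyclotomicRankZeroShimuraShaAn
import HarnessLib

/-!
# Route `RamifiedHeegnerPair`, crux U₀ `LeafRankZeroUpperAtThree` (stmt-BirchSwinnertonDyer-26024), line `splitkolyvagin0` —
# the INERT-CARRIER (Shimura-curve) road for U₀, part 1: the rank-ZERO Gross–Zagier bookkeeping with a rational factor of ANY valuation

HONEST FRAMING. Theorems only; helper file (`--supports stmt-BirchSwinnertonDyer-26024 --as helper`); nothing is booked, no item is
closed, BSD is not proved for any curve; CONDITIONAL on every displayed input. Lead prover bsd-line-rhp-p2 g10, 2026-08-28.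

Cell bsd-print-x6's `AnticyclotomicRankZero.exists_shaAn_padicVal_eq_of_gzIdentity_rankZero_ratFactor`
(`Theorems/PrintX6AnticyclotomicRankZeroShimuraShaAn.lean`) is the Gross–Zagier descent identity for `#Ш(E)_an` in analytic rank ZERO at
a point `P ∈ E(K)` with `L′(E/K,1) = ρ · grossZagierConstant Dt K · ĥ(P)`, for a rational `ρ > 0` that is a `p`-adic UNIT (there:
`ρ = deg φ_{Dt}/deg f` at a Shimura-curve Heegner point with NO Tamagawa-`p` carrier in `N⁻`). On the Gss2 leaf's INERT-CARRIER road the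
carriers ARE in `N⁻`, so `ord₃ ρ = Σ_{q ∈ N⁻} ord₃ ord_qΔ ≠ 0` (Ribet–Takahashi): this file is that theorem LETTER FOR LETTER with the
hypothesis `ord_p ρ = 0` DROPPED and `ord_p ρ` carried to the right-hand side of the identity:
`ord_p q + ord_p q_d + ord_p ∏c(E) + 2·ord_p #Wd(ℚ)_tors = 2·ord_p [E(K):ℤP] + ord_p ρ`.
-- adapted from Summits/BirchSwinnertonDyer/BirchSwinnertonDyer/Theorems/PrintX6AnticyclotomicRankZeroShimuraShaAn.lean

References: [CaiShuTian2014] Thm. 1.5 (pp. 2529–2530); [JetchevSkinnerWan2017] §7.4.1 (eq:gz for K′), §7.4.2, §7.3.1 (eq:tamK)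
(arXiv:1512.06894 pp. 29–31); [GrossZagier1986] V.§2; [Miller2011LMS] Def. 1.1.
-/

set_option linter.dupNamespace false
set_option autoImplicit false

noncomputable section

open scoped Classical

open WeierstrassCurve NumberField Literature.NumberTheory.EllipticCurves
  Literature.NumberTheory.EllipticCurves.ModularForms
  Literature.NumberTheory.EllipticCurves.KrizLi2019

namespace Summit.BirchSwinnertonDyer.BirchSwinnertonDyer.Theorems.LeafShimuraInert

open Summit.BirchSwinnertonDyer.BirchSwinnertonDyer.Theorems.AnticyclotomicRankZero

/-! ### The descent identity in analytic rank zero, Gross–Zagier identity with a rational factor of any valuation -/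

/-- **The Gross–Zagier bookkeeping identity for `ord_p #Ш(E)_an` in analytic rank ZERO at ANY imaginary quadratic field, from a
Gross–Zagier identity with a rational factor `ρ` of ARBITRARY `p`-adic valuation.** Data as in bsd-print-x6's
`AnticyclotomicRankZero.exists_shaAn_padicVal_eq_of_gzIdentity_rankZero_ratFactor` (`W/ℚ` globally minimal, `r_an = 0`; `K` imaginary
quadratic; `Dt` with `p ∤ c`; `P ∈ E(K)` with `L′(E/K,1) = ρ · grossZagierConstant Dt K · ĥ(P)`, `ρ > 0` rational; `p` odd, `p ∤ #𝓞_K^×`;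
`Wd = Cd • W^{(d_K)}` globally minimal with `ord_p u = 0` and `r_an = 1`; `q_d` with `L′(Wd,1) = q_d·Reg(Wd)·Ω(Wd)`; GZK, modularity) but
WITHOUT `ord_p ρ = 0`. CONCLUSION: `Ш(E)`, `Ш(Wd)` finite, `rank E(K) = 1`, `P` non-torsion, and `#Ш(E)_an = q ∈ ℚ` with
`ord_p q + ord_p q_d + ord_p ∏c(E) + 2·ord_p #Wd(ℚ)_tors = 2·ord_p [E(K):ℤP] + ord_p ρ`. Proof letter for letter (the unit hypothesis was
used once, in the last valuation). At a Shimura-curve Heegner point of the inert-carrier road `ord₃ ρ = Σ_{q∈N⁻} ord₃ ord_qΔ` (the (DEG)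
identity), which is how the carriers' Tamagawa numbers cancel for U₀ exactly as for U₁.
-- adapted from Summits/BirchSwinnertonDyer/BirchSwinnertonDyer/Theorems/PrintX6AnticyclotomicRankZeroShimuraShaAn.lean
[cite: CaiShuTian2014, Thm. 1.5 (pp. 2529–2530)] [cite: JetchevSkinnerWan2017, §7.4.1 (eq:gz for K′), §7.4.2 and §7.3.1 (eq:tamK), pp. 29–31 of arXiv:1512.06894]
[cite: GrossZagier1986, V.§2 (pp. 310–312)] [cite: Miller2011LMS, §1 and Def. 1.1] -/
theorem exists_shaAn_padicVal_eq_of_gzIdentity_rankZero_ratFactorVal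
    (W : WeierstrassCurve ℚ) [W.IsElliptic] [W.IsGloballyMinimal] (p : ℕ) [Fact p.Prime]
    (N : ℕ) [NeZero N] (K : Type) [Field K] [NumberField K]
    (Dt : ModularParametrizationData W N) (P : (W.baseChange K).toAffine.Point)
    (hGZK : rank_eq_analyticRank_of_analyticRank_le_one) (hmod : hasEntireLFunction_rat)
    (hK : IsImaginaryQuadratic K) (hp2 : p ≠ 2) (hc : ¬ (p : ℤ) ∣ Dt.c) (hμ : ¬ p ∣ Units.torsionOrder K)
    (hr : W.analyticRank = 0)
    (Wd : WeierstrassCurve ℚ) [Wd.IsElliptic] [Wd.IsGloballyMinimal] (Cd : VariableChange ℚ)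
    (hWd : Cd • W.quadraticTwist (NumberField.discr K : ℚ) = Wd)
    (hu : padicValRat p (Cd.u : ℚ) = 0)
    (hrd : Wd.analyticRank = 1)
    (qd : ℚ) (hqd : Wd.leadingLCoeff = (((qd : ℝ) * Wd.regulator * Wd.realPeriodRat : ℝ) : ℂ))
    (ρ : ℚ) (hρ0 : 0 < ρ) (hLD : LDerivEK W K =
      (((ρ : ℝ) * grossZagierConstant Dt K * P.canonicalHeight : ℝ) : ℂ)) :
    Finite W.sha ∧ Finite Wd.sha ∧ (W.baseChange K).mordellWeilRank = 1 ∧ ¬ IsOfFinAddOrder P ∧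
      ∃ q : ℚ, shaAn W = (q : ℂ) ∧
        padicValRat p q + padicValRat p qd + padicValNat p W.tamagawaProduct +
            2 * padicValNat p Wd.torsionOrder =
          2 * padicValNat p (AddSubgroup.zmultiples P).index + padicValRat p ρ := by
  have hpp : p.Prime := Fact.out
  unfold grossZagierConstant at hLD
  haveI hEK : (W.baseChange K).IsElliptic := isElliptic_baseChange' W K
  obtain ⟨h2, hKtc⟩ := hK
  haveI : IsTotallyComplex K := hKtc
  have hD0 : (NumberField.discr K : ℚ) ≠ 0 := by exact_mod_cast NumberField.discr_ne_zero K
  haveI hEt : (W.quadraticTwist (NumberField.discr K : ℚ)).IsElliptic :=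
    W.isElliptic_quadraticTwist hD0
  ---------------------------------------------------------------- `L`-values over `ℚ` and `K`
  have hrt : (W.quadraticTwist (NumberField.discr K : ℚ)).analyticRank = 1 := by
    rw [← analyticRank_smul (W.quadraticTwist _) Cd, hWd, hrd]
  have hLt0 : (W.quadraticTwist (NumberField.discr K : ℚ)).entireLFunction 1 = 0 :=
    entireLFunction_one_eq_zero_of_analyticRank_eq_one hrt
  obtain ⟨hleadd, hderivd⟩ := leadingLCoeff_eq_deriv_of_analyticRank_eq_one hrd
  have hLt' : (W.quadraticTwist (NumberField.discr K : ℚ)).entireLFunction = Wd.entireLFunction := by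
    rw [← hWd, entireLFunction_smul]
  have hprod := lDerivEK_eq_mul_deriv hmod W K hLt0
  have hL1 : W.entireLFunction 1 ≠ 0 := (W.analyticRank_eq_zero_iff_holds (hmod W)).1 hr
  have hLK : LDerivEK W K ≠ 0 := by
    rw [hprod, hLt']; exact mul_ne_zero hL1 hderivd
  ---------------------------------------------------------------- the point is non-torsion (`L'(E/K,1) ≠ 0`)
  have hPinf : ¬ IsOfFinAddOrder P := by
    intro htor
    have hh : P.canonicalHeight = 0 :=
      (WeierstrassCurve.Affine.Point.canonicalHeight_eq_zero_iff_holds P).mpr htor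
    rw [hLD, hh, mul_zero, Complex.ofReal_zero] at hLK
    exact hLK rfl
  ---------------------------------------------------------------- Gross–Zagier–Kolyvagin for `W` and `Wd`; rank over `K`
  have hr1 : W.analyticRank ≤ 1 := by omega
  obtain ⟨hrankW, hShaW⟩ := hGZK W hr1
  haveI hfinW : Finite W.sha := hShaW
  have hrQ : W.mordellWeilRank = 0 := by rw [hrankW, hr]
  have hrkt : (W.quadraticTwist (NumberField.discr K : ℚ)).mordellWeilRank = 1 := by
    rw [(hGZK _ (le_of_eq hrt)).1, hrt]
  haveI : Module.Finite ℤ (W.baseChange K).toAffine.Point := (W.baseChange K).module_finite_point_holds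
  have hrkK : (W.baseChange K).mordellWeilRank = 1 := by
    rw [W.mordellWeilRank_baseChange_of_finrank_eq_two_of_finite K h2, hrQ, hrkt]
  haveI hfinQ : Finite W.toAffine.Point := W.finite_point_of_rank_zero hrQ
  have hRW : W.regulator = 1 := W.regulator_eq_one_of_rank_zero hrQ
  have hrd1 : Wd.analyticRank ≤ 1 := le_of_eq hrd
  obtain ⟨hrankd, hShad⟩ := hGZK Wd hrd1
  have hrkd : Wd.mordellWeilRank = 1 := by rw [hrankd, hrd]
  haveI hfinSd : Finite Wd.sha := hShad
  ---------------------------------------------------------------- heights and index (the free part is the twist's)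
  obtain ⟨m, hm, hheight⟩ :=
    exists_mul_canonicalHeight_eq_index_sq_mul_regulator_twist W K h2 Wd ⟨Cd, hWd⟩ hrkK hrkd P hPinf
  ---------------------------------------------------------------- Gross–Zagier and the period
  have hper := two_mul_covolume_div_sqrt_eq_bsdPeriod W K Dt h2
  have hΩ := W.realPeriod_mul_realPeriod_quadraticTwist_eq_mul_bsdPeriod K h2
  have hΩd : Wd.realPeriodRat =
      |((Cd.u : ℚ) : ℝ)| * (W.quadraticTwist (NumberField.discr K : ℚ)).realPeriodRat := by
    rw [← hWd]; exact realPeriodRat_smul_holds (W.quadraticTwist _) Cd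
  ---------------------------------------------------------------- the twist's `L`-derivative
  have hderiv_eq : deriv (W.quadraticTwist (NumberField.discr K : ℚ)).entireLFunction 1 =
      (((qd : ℝ) * Wd.regulator * Wd.realPeriodRat : ℝ) : ℂ) := by
    rw [hLt', ← hleadd, hqd]
  have hqd0 : qd ≠ 0 := by
    intro h0
    apply hderivd
    rw [← hleadd, hqd, h0]; simp
  ---------------------------------------------------------------- positivity of everything
  have hΩW : 0 < W.realPeriodRat := W.realPeriodRat_pos_holds
  have hΩt : 0 < (W.quadraticTwist (NumberField.discr K : ℚ)).realPeriodRat :=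
    (W.quadraticTwist _).realPeriodRat_pos_holds
  have hRd : 0 < Wd.regulator := Wd.regulator_pos'
  have hcW : 0 < W.tamagawaProduct := W.tamagawaProduct_pos_holds
  have htW : 0 < W.torsionOrder := W.torsionOrder_pos_holds
  have htK : 0 < (W.baseChange K).torsionOrder := (W.baseChange K).torsionOrder_pos_holds
  have htd : 0 < Wd.torsionOrder := Wd.torsionOrder_pos_holds
  have hcM : (Dt.c : ℚ) ≠ 0 := by
    have : Dt.c ≠ 0 := by rintro h0; exact hc (h0 ▸ dvd_zero (p : ℤ))
    exact_mod_cast this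
  have hw : 0 < Units.torsionOrder K := Units.torsionOrder_pos K
  have huu : (Cd.u : ℚ) ≠ 0 := Cd.u.ne_zero
  have hm0 : 0 < m := by rcases hm with rfl | rfl <;> norm_num
  have hI0 : (AddSubgroup.zmultiples P).index ≠ 0 := by
    intro hI
    rw [hI] at hheight
    have h0 : (m : ℝ) * ((W.baseChange K).torsionOrder : ℝ) ^ 2 * P.canonicalHeight = 0 := by
      rw [hheight]; simp
    have hh0 : P.canonicalHeight = 0 := by
      rcases mul_eq_zero.mp h0 with h' | h'
      · rcases mul_eq_zero.mp h' with h'' | h''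
        · exact absurd (by exact_mod_cast h'' : m = 0) hm0.ne'
        · exact absurd (pow_eq_zero_iff two_ne_zero |>.mp h'') (by exact_mod_cast htK.ne')
      · exact h'
    exact hPinf ((Affine.Point.canonicalHeight_eq_zero_iff_holds P).mp hh0)
  set n := (W.baseChange ℝ).numRealComponents with hn_def
  have hn : n = 1 ∨ n = 2 := numRealComponents_eq_one_or W
  have hn0 : 0 < n := by rcases hn with h' | h' <;> omega
  ---------------------------------------------------------------- the rational number `q = #Ш_an`
  set I := (AddSubgroup.zmultiples P).index with hI_def
  set q : ℚ := 8 * (I : ℚ) ^ 2 * (W.torsionOrder : ℚ) ^ 2 * ρ /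
      ((n : ℚ) * (m : ℚ) * ((W.baseChange K).torsionOrder : ℚ) ^ 2 * (Dt.c : ℚ) ^ 2 *
        (Units.torsionOrder K : ℚ) ^ 2 * qd * |(Cd.u : ℚ)| * (W.tamagawaProduct : ℚ))
    with hq_def
  ---------------------------------------------------------------- real abbreviations
  set ΩW := W.realPeriodRat with hΩW_def
  set Ωt := (W.quadraticTwist (NumberField.discr K : ℚ)).realPeriodRat with hΩt_def
  set B := (W.baseChange K).bsdPeriod with hB_def
  set Rd := Wd.regulator with hRd_def
  set hh := P.canonicalHeight with hhh_def
  set tK := (W.baseChange K).torsionOrder with htK_def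
  set tW := W.torsionOrder with htW_def
  set td := Wd.torsionOrder with htd_def
  set cW := W.tamagawaProduct with hcW_def
  set w := Units.torsionOrder K with hw_def
  set cM := Dt.c with hcM_def
  set u := (Cd.u : ℚ) with hu_def
  have hΩW' : ΩW = (W.baseChange ℝ).realPeriod := rfl
  have hΩt' : Ωt = ((W.quadraticTwist (NumberField.discr K : ℚ)).baseChange ℝ).realPeriod := rfl
  rw [← hΩW', ← hΩt'] at hΩ
  -- `B = ΩW Ωt / n`, `ĥ = 2 I² Rd / (m tK²)`, the Gross–Zagier constant `= 4 B / (c² w²)`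
  have hBeq : B = ΩW * Ωt / n := by
    rw [hΩ]; field_simp
  have hheq : hh = 2 * (I : ℝ) ^ 2 * Rd / ((m : ℝ) * (tK : ℝ) ^ 2) := by
    rw [← hheight]; field_simp
  have hGZc : 2 * ZLattice.covolume Dt.L.lattice /
        ((cM : ℝ) ^ 2 * ((w : ℝ) / 2) ^ 2 * √|(NumberField.discr K : ℝ)|) =
      4 * B / ((cM : ℝ) ^ 2 * (w : ℝ) ^ 2) := by
    rw [← hper]; field_simp; ring
  -- the twist's derivative as a real number
  have hLdr : deriv (W.quadraticTwist (NumberField.discr K : ℚ)).entireLFunction 1 =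
      (((qd : ℝ) * Rd * (|(u : ℝ)| * Ωt) : ℝ) : ℂ) := by
    rw [hderiv_eq, hΩd]
  have hLdne : ((qd : ℝ) * Rd * (|(u : ℝ)| * Ωt) : ℝ) ≠ 0 := by
    have hu' : |(u : ℝ)| ≠ 0 := abs_ne_zero.mpr (by exact_mod_cast huu)
    have hqd' : (qd : ℝ) ≠ 0 := by exact_mod_cast hqd0
    exact mul_ne_zero (mul_ne_zero hqd' hRd.ne') (mul_ne_zero hu' hΩt.ne')
  set X : ℝ := ((ρ : ℝ) * (4 * B / ((cM : ℝ) ^ 2 * (w : ℝ) ^ 2)) * hh) /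
      ((qd : ℝ) * Rd * (|(u : ℝ)| * Ωt)) with hX_def
  have hL1v : W.entireLFunction 1 = ((X : ℝ) : ℂ) := by
    have hne : ((((qd : ℝ) * Rd * (|(u : ℝ)| * Ωt) : ℝ)) : ℂ) ≠ 0 := by exact_mod_cast hLdne
    have key : W.entireLFunction 1 * ((((qd : ℝ) * Rd * (|(u : ℝ)| * Ωt) : ℝ)) : ℂ) =
        (((ρ : ℝ) * (4 * B / ((cM : ℝ) ^ 2 * (w : ℝ) ^ 2)) * hh : ℝ) : ℂ) := by
      rw [← hLdr, ← hprod, hLD, hGZc]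
    rw [hX_def, Complex.ofReal_div, ← key, mul_div_cancel_right₀ _ hne]
  have hlead0 : W.leadingLCoeff = W.entireLFunction 1 := W.leadingLCoeff_eq_of_analyticRank_eq_zero hr
  have hshaAnR : shaAn W = ((X * (tW : ℝ) ^ 2 / (ΩW * (cW : ℝ)) : ℝ) : ℂ) := by
    rw [shaAn_def, hlead0, hL1v, hRW]
    push_cast
    simp only [mul_one]
    rfl
  have hXq : X * (tW : ℝ) ^ 2 / (ΩW * (cW : ℝ)) = (q : ℝ) := by
    have hn' : (n : ℝ) ≠ 0 := by exact_mod_cast hn0.ne'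
    have hm' : (m : ℝ) ≠ 0 := by exact_mod_cast hm0.ne'
    have htK' : (tK : ℝ) ≠ 0 := by exact_mod_cast htK.ne'
    have htW' : (tW : ℝ) ≠ 0 := by exact_mod_cast htW.ne'
    have hcW' : (cW : ℝ) ≠ 0 := by exact_mod_cast hcW.ne'
    have hcM' : (cM : ℝ) ≠ 0 := by
      exact_mod_cast (show cM ≠ 0 by rintro h0; exact hc (h0 ▸ dvd_zero (p : ℤ)))
    have hw' : (w : ℝ) ≠ 0 := by exact_mod_cast hw.ne'
    have hu' : |(u : ℝ)| ≠ 0 := abs_ne_zero.mpr (by exact_mod_cast huu)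
    have hI' : (I : ℝ) ≠ 0 := by exact_mod_cast hI0
    have hqd' : (qd : ℝ) ≠ 0 := by exact_mod_cast hqd0
    have hRd' : (Rd : ℝ) ≠ 0 := hRd.ne'
    have hρ' : (ρ : ℝ) ≠ 0 := by exact_mod_cast hρ0.ne'
    rw [hX_def, hheq, hBeq, hq_def]
    push_cast
    field_simp
    ring
  have hshaAn : shaAn W = (q : ℂ) := by
    rw [hshaAnR, hXq]; norm_cast
  ---------------------------------------------------------------- `p`-adic valuations
  -- torsion: `v_p(tK) = v_p(tW) + v_p(td)`
  obtain ⟨θ, c, hθ, hcθ⟩ :=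
    Literature.NumberTheory.QuadraticFields.Quadratic.exists_sq_eq_algebraMap (F := ℚ) (K := K) h2
  obtain ⟨qq, hqq, hdq⟩ := NumberField.exists_discr_eq_mul_sq h2 hθ hcθ
  have htors : padicValNat p tK = padicValNat p tW + padicValNat p td :=
    padicValNat_torsionOrder_baseChange_quadratic_anyRank W K h2 hθ hcθ hqq hdq ⟨Cd, hWd⟩ p hp2
  -- valuation of `q`
  have hI' : (I : ℚ) ≠ 0 := by exact_mod_cast hI0
  have htW' : (tW : ℚ) ≠ 0 := by exact_mod_cast htW.ne'
  have htK' : (tK : ℚ) ≠ 0 := by exact_mod_cast htK.ne'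
  have hn' : (n : ℚ) ≠ 0 := by exact_mod_cast hn0.ne'
  have hm' : (m : ℚ) ≠ 0 := by exact_mod_cast hm0.ne'
  have hcW' : (cW : ℚ) ≠ 0 := by exact_mod_cast hcW.ne'
  have hw' : (w : ℚ) ≠ 0 := by exact_mod_cast hw.ne'
  have hua : |u| ≠ 0 := abs_ne_zero.mpr huu
  have h8 : padicValRat p (8 : ℚ) = 0 := by
    rw [show (8 : ℚ) = ((8 : ℕ) : ℚ) by norm_num, padicValRat.of_nat]
    have : ¬ p ∣ 8 := by
      intro h
      have h' : p ∣ 2 ^ 3 := by simpa using h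
      exact hp2 ((Nat.prime_dvd_prime_iff_eq hpp Nat.prime_two).mp (hpp.dvd_of_dvd_pow h'))
    simp [padicValNat.eq_zero_of_not_dvd this]
  have hvn : padicValRat p (n : ℚ) = 0 := by
    rw [padicValRat.of_nat]
    have : ¬ p ∣ n := by
      rcases hn with h' | h'
      · rw [h']; exact hpp.one_lt.ne' ∘ Nat.dvd_one.mp
      · rw [h']; intro hd; exact hp2 ((Nat.prime_dvd_prime_iff_eq hpp Nat.prime_two).mp hd)
    simp [padicValNat.eq_zero_of_not_dvd this]
  have hvm : padicValRat p (m : ℚ) = 0 := by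
    rw [padicValRat.of_nat]
    have : ¬ p ∣ m := by
      rcases hm with rfl | rfl
      · exact hpp.one_lt.ne' ∘ Nat.dvd_one.mp
      · intro hd
        have h' : p ∣ 2 ^ 2 := by simpa using hd
        exact hp2 ((Nat.prime_dvd_prime_iff_eq hpp Nat.prime_two).mp (hpp.dvd_of_dvd_pow h'))
    simp [padicValNat.eq_zero_of_not_dvd this]
  have hvc : padicValRat p (cM : ℚ) = 0 := by
    rw [padicValRat.of_int, padicValInt.eq_zero_of_not_dvd hc]; rfl
  have hvw : padicValRat p (w : ℚ) = 0 := by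
    rw [padicValRat.of_nat, padicValNat.eq_zero_of_not_dvd hμ]; rfl
  have hvu : padicValRat p |u| = 0 := by
    rcases abs_choice u with h' | h'
    · rw [h']; exact hu
    · rw [h', padicValRat.neg]; exact hu
  have hval : padicValRat p q + padicValRat p qd + padicValNat p cW +
      2 * padicValNat p td = 2 * padicValNat p I + padicValRat p ρ := by
    -- nonvanishing of the partial products
    have hA1 : (8 : ℚ) * (I : ℚ) ^ 2 ≠ 0 := mul_ne_zero (by norm_num) (pow_ne_zero _ hI')
    have hA2 : (8 : ℚ) * (I : ℚ) ^ 2 * (tW : ℚ) ^ 2 ≠ 0 := mul_ne_zero hA1 (pow_ne_zero _ htW')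
    have hρne : ρ ≠ 0 := hρ0.ne'
    have hA3 : (8 : ℚ) * (I : ℚ) ^ 2 * (tW : ℚ) ^ 2 * ρ ≠ 0 := mul_ne_zero hA2 hρne
    have hD1 : (n : ℚ) * (m : ℚ) ≠ 0 := mul_ne_zero hn' hm'
    have hD2 : (n : ℚ) * (m : ℚ) * (tK : ℚ) ^ 2 ≠ 0 := mul_ne_zero hD1 (pow_ne_zero _ htK')
    have hD3 : (n : ℚ) * (m : ℚ) * (tK : ℚ) ^ 2 * (cM : ℚ) ^ 2 ≠ 0 :=
      mul_ne_zero hD2 (pow_ne_zero _ hcM)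
    have hD4 : (n : ℚ) * (m : ℚ) * (tK : ℚ) ^ 2 * (cM : ℚ) ^ 2 * (w : ℚ) ^ 2 ≠ 0 :=
      mul_ne_zero hD3 (pow_ne_zero _ hw')
    have hD5 : (n : ℚ) * (m : ℚ) * (tK : ℚ) ^ 2 * (cM : ℚ) ^ 2 * (w : ℚ) ^ 2 * qd ≠ 0 :=
      mul_ne_zero hD4 hqd0
    have hD6 : (n : ℚ) * (m : ℚ) * (tK : ℚ) ^ 2 * (cM : ℚ) ^ 2 * (w : ℚ) ^ 2 * qd * |u| ≠ 0 :=
      mul_ne_zero hD5 hua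
    have hD7 : (n : ℚ) * (m : ℚ) * (tK : ℚ) ^ 2 * (cM : ℚ) ^ 2 * (w : ℚ) ^ 2 * qd * |u| *
        (cW : ℚ) ≠ 0 := mul_ne_zero hD6 hcW'
    have hnum : padicValRat p ((8 : ℚ) * (I : ℚ) ^ 2 * (tW : ℚ) ^ 2 * ρ) =
        2 * padicValNat p I + 2 * padicValNat p tW + padicValRat p ρ := by
      rw [padicValRat.mul hA2 hρne, padicValRat.mul hA1 (pow_ne_zero _ htW'),
        padicValRat.mul (by norm_num) (pow_ne_zero _ hI'),
        padicValRat.pow, padicValRat.pow, h8, padicValRat.of_nat, padicValRat.of_nat]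
      push_cast; ring
    have hden : padicValRat p ((n : ℚ) * (m : ℚ) * (tK : ℚ) ^ 2 * (cM : ℚ) ^ 2 * (w : ℚ) ^ 2 *
        qd * |u| * (cW : ℚ)) =
        2 * padicValNat p tK + padicValRat p qd + padicValNat p cW := by
      rw [padicValRat.mul hD6 hcW', padicValRat.mul hD5 hua, padicValRat.mul hD4 hqd0,
        padicValRat.mul hD3 (pow_ne_zero _ hw'), padicValRat.mul hD2 (pow_ne_zero _ hcM),
        padicValRat.mul hD1 (pow_ne_zero _ htK'), padicValRat.mul hn' hm', padicValRat.pow,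
        padicValRat.pow, padicValRat.pow, hvn, hvm, hvc, hvw, hvu, padicValRat.of_nat,
        padicValRat.of_nat]
      push_cast; ring
    rw [hq_def, padicValRat.div hA3 hD7, hnum, hden]
    have e2 : (padicValNat p tK : ℤ) = padicValNat p tW + padicValNat p td := by exact_mod_cast htors
    omega
  exact ⟨hfinW, hfinSd, hrkK, hPinf, q, hshaAn, hval⟩

end Summit.BirchSwinnertonDyer.BirchSwinnertonDyer.Theorems.LeafShimuraInert

end
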